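import Literature.MathematicalPhysics.QuantumManyBody.HeatFlow
import Literature.MathematicalPhysics.QuantumManyBody.DiluteBoseGasUpperBoundLocalization
import HarnessLib

/-!
# The periodic (`torus`) `N`-body Schrödinger heat flow `e^{-tH_N^per} ψ₀` through Feynman–Kac

Topic `Literature/MathematicalPhysics/QuantumManyBody` (definition item `defn-periodicHeatFlow`;
wanted by route `BECCovarianceTransport`, item `stmt-AtomisticToContinuum-12687`, whose flow
cruxes currently inline the formula over `worldLine` / `wienerPaths` / `expNeg` /
`periodicInteraction`). The TORUS companion of the Dirichlet flow `heatFlow` (`HeatFlow.lean`):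
same canonical Wiener world-lines `Bⁱ_s = Xᵢ + √2 bⁱ_s` on `(ℝ³)^N`
(`GroundStateFeynmanKac.lean`), the pair action PERIODISED (`periodicInteraction v L`,
`PeriodicBoseGas.lean`: `∑_{i<j} v^per(xᵢ - xⱼ)`, `v^per(x) = ∑_{n ∈ ℤ³} v(|x - Ln|)`), and NO
killing: the world-lines live on the covering space `(ℝ³)^N` of the torus `((ℝ/Lℤ)³)^N` and periodic
data are read along them.

## Content

* `periodicPathAction v L T X ω = ∫₀ᵀ ∑_{i<j} v^per(Bⁱ_s - Bʲ_s) ds ∈ [0, ∞]`,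
  `periodicFKWeight = e^{-periodicPathAction} ∈ [0, 1]` (`e^{-∞} = 0`: hard cores kill on contact),
  `periodicFKPathMeasure v L T X = e^{-∫₀ᵀ V^per} dW_X` (a sub-probability measure on path space),
  `periodicFKSemigroup v L T g X = E_X[e^{-∫₀ᵀ V^per(B_s)ds} g(B_T)]` for `g ≥ 0` (`[0,∞]`-valued), and
  **the definition** `periodicHeatFlow v N L t ψ₀ : Config N → ℂ`,
  `(periodicHeatFlow v N L t ψ₀)(X) = E[e^{-∫₀ᵗ ∑_{i<j} v^per(Bⁱ_s-Bʲ_s) ds} ψ₀(B_t)]`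
  (`periodicHeatFlow_apply`, by `rfl`, is literally the formula the route writes inline). For
  `Lℤ³`-periodic `ψ₀` this is the Feynman–Kac (Wiener-integral) representation of
  `(e^{-tH_N^per} ψ₀)(X)`, `H_N^per = -∑ⱼ Δⱼ + ∑_{i<j} v^per(xᵢ - xⱼ)` on the torus of side `L`
  (`ħ = 2m = 1`; the Brownian motion of the flat torus is the projection of the Brownian motion of
  its covering space, and a periodic potential / periodic data are functions on the torus:
  Chung–Zhao's Feynman–Kac semigroup (26) of the projected process, Freidlin's identification of
  the periodic-coefficient semigroup on periodic functions with the torus semigroup); taken here as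
  the DEFINITION of the flow.
* Proved API (mirroring `HeatFlow.lean`): unfolding; `t ≤ 0` gives `ψ₀`; linearity (`smul` always,
  `add` on bounded measurable data); complex conjugation; real data stay real, nonnegative data stay
  nonnegative and are computed by `periodicFKSemigroup` (`periodicHeatFlow_ofReal_eq_periodicFKSemigroup`);
  the pointwise domination `‖Φ_t(X)‖ₑ ≤ (e^{-tH}‖ψ₀‖)(X)` and the sup bound; **covariance under
  translations** — by lattice vectors in one particle (`periodicHeatFlow_add_single`) and by a common
  vector in all particles (`periodicHeatFlow_add_const`) — whence **periodic data stay periodic**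
  (`periodicHeatFlow_add_single_of_periodic`); **Bose symmetry** (`periodicHeatFlow_comp_perm`,
  from `periodicInteraction_comp_equiv`); measurability of `periodicHeatFlow v N L t ψ₀` (joint
  measurability of the weight in `(X, ω)`); insensitivity to null modifications of the data for
  `t > 0`; the **`L²`-contraction on the fundamental cell** for periodic data,
  `∫_{[0,L)^{3N}} ‖Φ_t‖² ≤ ∫_{[0,L)^{3N}} ‖ψ₀‖²` (Jensen under the sub-probability path measure,
  Tonelli, and the shift invariance of cell integrals of periodic functions,
  `lintegral_cellN_comp_add` of `PeriodicBoseGasEq317.lean`), with its whole-space and `L¹`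
  companions; the **semigroup law** `e^{-(s+t)H}ψ₀ = e^{-sH}(e^{-tH}ψ₀)` for bounded measurable
  data and every measurable `v : ℝ → [0, ∞]` (`periodicHeatFlow_semigroup`: the Markov property of
  the `3N` Brownian coordinates, `lintegral_comp_pathsShift_eq` of
  `GroundStateFeynmanKacMarkov.lean`, applied to the raw periodic weight, then transferred to
  complex data by `eq_of_eq_on_ofReal_nonneg`), whence `t ↦ ∫_cell ‖e^{-tH}ψ₀‖²` is non-increasing.

## Conventions

Time is a real parameter; for `t ≤ 0` the action is over the empty interval and `B_{t⁺} = B_0 = X`,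
so `periodicHeatFlow v N L t ψ₀ = ψ₀` (at `t = 0` this is the correct value; for `t < 0` a harmless
junk extension). The action is `∫⁻ s in Ioc 0 t`; the route writes `Icc 0 t`, the same integral
(`periodicPathAction_eq_lintegral_Icc`). The flow is defined for ALL data `ψ₀ : (ℝ³)^N → ℂ` and all
`L`; it is the torus flow on `Lℤ³`-periodic data (periodicity in every particle and axis, stated on
the generators `X ↦ X + L e_{i,k}` as in `PeriodicTrialState`), and the cell statements carry
`0 < L`.

## What is NOT here (documented for the requesting route)

No named fact is introduced in this file. The symmetry `⟨φ, e^{-tH}ψ⟩_cell = ⟨e^{-tH}φ, ψ⟩_cell`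
(time reversal, as in `GroundStateFeynmanKacSymmetry.lean`, plus a periodisation of the `dX`
integral), strong continuity in `t`, and the spectral / Perron–Frobenius layer on the torus — the
spectral measure of `t ↦ ⟨ψ₀, e^{-tH}ψ₀⟩_cell` for bounded `v^per` (log-convexity of
`Z(t) = ‖e^{-tH}𝟙‖²_cell`), the identification of the bottom of the symmetric spectrum with
`periodicGroundStateEnergy v N L`, and the ground-state projection `e^{tE₀}e^{-tH}g → ⟨Ψ₀, g⟩Ψ₀` —
are the business of the sequel `PeriodicHeatFlowSpectral.lean` (hypothesis structure
`IsPeriodicGroundStateFK` and the named facts of the torus theory, stated for BOUNDED periodised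
potentials: for a bounded `v` of infinite range `v^per ≡ ∞` and the flow is trivial). For hard cores
(`v = ⊤` on a set of radii) the flow is defined and all theorems of this file apply, but the
semigroup is not strongly continuous at `t = 0` on all of `L²(cell)`.

## References

* K. L. Chung, Z. Zhao, *From Brownian Motion to Schrödinger's Equation*, Grundlehren 312 (1995):
  §3.2 (16)–(17), (26) (the Feynman–Kac semigroup `T_t f(x) = E^x{e_q(t) f(X_t)}` of a symmetric
  Hunt process — here Brownian motion on the flat torus — and its semigroup property from the
  Markov property), Thm 3.10. [ChungZhao1995]
* M. I. Freidlin, *Functional Integration and Partial Differential Equations*, Ann. of Math.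
  Studies 109 (1985), Ch. VII §7.2, (2.12)–(2.13): for periodic coefficients the Feynman–Kac
  semigroup on periodic functions of `ℝ^r` is the semigroup of the projected process on the torus
  `T^r = ℝ^r/ℤ^r`.
* J. Ginibre, *Reduced density matrices of quantum gases. I*, J. Math. Phys. 6 (1965): the
  Wiener-integral representation of `e^{-βH_N}` for quantum gases in a box. [Ginibre1965]
-/

noncomputable section

open MeasureTheory Filter Metric
open scoped ENNReal NNReal Topology ComplexConjugate

namespace Literature.MathematicalPhysics.QuantumManyBody.BoseGas

open Literature.Probability.Process (preWienerMeasure brownian brownian_zero measurable_brownian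
  continuous_brownian)

variable {N : ℕ}

/-! ### The periodised action, the weight and the definition -/

/-- The **periodised pair action** `∫₀ᵀ ∑_{i<j} v^per(Bⁱ_s - Bʲ_s) ds ∈ [0, ∞]` of the `N`
world-lines `Bⁱ_s = Xᵢ + √2 bⁱ_s` along the sample `ω` (lower Lebesgue integral over `s ∈ (0, T]`;
`v^per = periodizedPotential v L`). [folklore] -/
def periodicPathAction (v : ℝ → ℝ≥0∞) (L T : ℝ) (X : Config N) (ω : PathSpace N) : ℝ≥0∞ :=
  ∫⁻ s in Set.Ioc (0 : ℝ) T, periodicInteraction v L (worldLine X ω s.toNNReal)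

/-- The **periodic Feynman–Kac weight** `exp(-∫₀ᵀ ∑_{i<j} v^per(Bⁱ_s - Bʲ_s) ds) ∈ [0, 1]` of a
sample (no killing: the torus has no boundary; `e^{-∞} = 0`). [folklore] -/
def periodicFKWeight (v : ℝ → ℝ≥0∞) (L T : ℝ) (X : Config N) (ω : PathSpace N) : ℝ≥0∞ :=
  expNeg (periodicPathAction v L T X ω)

/-- The **interaction-weighted path measure** `exp(-∫₀ᵀ ∑_{i<j} v^per) dW_X` of the `N` world-lines
on `[0, T]` started at `X` (a sub-probability measure on `PathSpace N`). [folklore] -/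
def periodicFKPathMeasure (v : ℝ → ℝ≥0∞) (L T : ℝ) (X : Config N) : Measure (PathSpace N) :=
  (wienerPaths N).withDensity (periodicFKWeight v L T X)

/-- The **periodic Feynman–Kac functional** `E_X[exp(-∫₀ᵀ ∑_{i<j} v^per(Bⁱ_s - Bʲ_s) ds) g(B_T)]`
for `g : (ℝ³)^N → [0, ∞]`: for `Lℤ³`-periodic `g` the torus Schrödinger semigroup
`(e^{-T H_N^per} g)(X)` evaluated path-wise. [folklore] -/
def periodicFKSemigroup (v : ℝ → ℝ≥0∞) (L T : ℝ) (g : Config N → ℝ≥0∞) (X : Config N) : ℝ≥0∞ :=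
  ∫⁻ ω, periodicFKWeight v L T X ω * g (worldLine X ω T.toNNReal) ∂wienerPaths N

/-- **The periodic `N`-body Schrödinger heat flow through Feynman–Kac.**
`(periodicHeatFlow v N L t ψ₀)(X) = E[exp(-∫₀ᵗ ∑_{i<j} v^per(Bⁱ_s - Bʲ_s) ds) · ψ₀(B_t)]`, the
expectation over the `N` world-lines `Bⁱ_s = Xᵢ + √2 bⁱ_s` (`3N` independent standard Brownian
coordinates, canonical Wiener space of the tree), weighted by the PERIODISED pair action
(`v^per(x) = ∑_{n∈ℤ³} v(|x - Ln|)`) and NOT killed. For `Lℤ³`-periodic `ψ₀` this is the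
Wiener-integral representation of `(e^{-tH_N^per} ψ₀)(X)` for
`H_N^per = -∑ⱼΔⱼ + ∑_{i<j} v^per(xᵢ-xⱼ)` on the torus `((ℝ/Lℤ)³)^N` (`ħ = 2m = 1`), taken as the
definition of the flow; for `t ≤ 0` it returns `ψ₀`. [folklore] -/
def periodicHeatFlow (v : ℝ → ℝ≥0∞) (N : ℕ) (L : ℝ) (t : ℝ) (ψ₀ : Config N → ℂ) : Config N → ℂ :=
  fun X => ∫ ω, (periodicFKWeight v L t X ω).toReal • ψ₀ (worldLine X ω t.toNNReal) ∂wienerPaths N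

/-- Unfolding `periodicHeatFlow` down to the formula the route `BECCovarianceTransport` writes
inline: `∫ expNeg(∫₀ᵗ periodicInteraction v L (B_s) ds) · ψ₀(B_t) dW`. [folklore] -/
theorem periodicHeatFlow_apply (v : ℝ → ℝ≥0∞) (L t : ℝ) (ψ₀ : Config N → ℂ) (X : Config N) :
    periodicHeatFlow v N L t ψ₀ X =
      ∫ ω, (expNeg (∫⁻ s in Set.Ioc (0 : ℝ) t,
        periodicInteraction v L (worldLine X ω s.toNNReal))).toReal •
          ψ₀ (worldLine X ω t.toNNReal) ∂wienerPaths N := rfl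

/-- `periodicHeatFlow` in terms of the named weight. [folklore] -/
theorem periodicHeatFlow_eq (v : ℝ → ℝ≥0∞) (L t : ℝ) (ψ₀ : Config N → ℂ) (X : Config N) :
    periodicHeatFlow v N L t ψ₀ X =
      ∫ ω, (periodicFKWeight v L t X ω).toReal • ψ₀ (worldLine X ω t.toNNReal) ∂wienerPaths N :=
  rfl

/-! ### The action and the weight: elementary properties -/

/-- The action may be integrated over `[0, T]` instead of `(0, T]`. [folklore] -/
theorem periodicPathAction_eq_lintegral_Icc (v : ℝ → ℝ≥0∞) (L T : ℝ) (X : Config N)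
    (ω : PathSpace N) :
    periodicPathAction v L T X ω =
      ∫⁻ s in Set.Icc (0 : ℝ) T, periodicInteraction v L (worldLine X ω s.toNNReal) := by
  rw [periodicPathAction, Measure.restrict_congr_set Ioc_ae_eq_Icc]

/-- For `T ≤ 0` the action vanishes (empty time interval). [folklore] -/
theorem periodicPathAction_of_nonpos (v : ℝ → ℝ≥0∞) (L : ℝ) {T : ℝ} (hT : T ≤ 0) (X : Config N)
    (ω : PathSpace N) : periodicPathAction v L T X ω = 0 := by
  simp [periodicPathAction, Set.Ioc_eq_empty (not_lt.2 hT)]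

/-- The weight is at most `1`. [folklore] -/
theorem periodicFKWeight_le_one (v : ℝ → ℝ≥0∞) (L T : ℝ) (X : Config N) (ω : PathSpace N) :
    periodicFKWeight v L T X ω ≤ 1 :=
  expNeg_le_one _

/-- The weight is finite. [folklore] -/
theorem periodicFKWeight_ne_top (v : ℝ → ℝ≥0∞) (L T : ℝ) (X : Config N) (ω : PathSpace N) :
    periodicFKWeight v L T X ω ≠ ⊤ :=
  ((periodicFKWeight_le_one v L T X ω).trans_lt ENNReal.one_lt_top).ne

/-- The weight vanishes exactly when the action is infinite (hard cores kill on contact).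
[folklore] -/
theorem periodicFKWeight_eq_zero_iff (v : ℝ → ℝ≥0∞) (L T : ℝ) (X : Config N) (ω : PathSpace N) :
    periodicFKWeight v L T X ω = 0 ↔ periodicPathAction v L T X ω = ⊤ := by
  unfold periodicFKWeight expNeg
  split_ifs with h
  · simp [h]
  · simp [h, (Real.exp_pos _)]

/-- For `T ≤ 0` the weight is `1`. [folklore] -/
theorem periodicFKWeight_of_nonpos (v : ℝ → ℝ≥0∞) (L : ℝ) {T : ℝ} (hT : T ≤ 0) (X : Config N)
    (ω : PathSpace N) : periodicFKWeight v L T X ω = 1 := by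
  simp [periodicFKWeight, periodicPathAction_of_nonpos v L hT]

/-- The real weight is in `[0, 1]`: nonnegativity. [folklore] -/
theorem toReal_periodicFKWeight_nonneg (v : ℝ → ℝ≥0∞) (L T : ℝ) (X : Config N) (ω : PathSpace N) :
    0 ≤ (periodicFKWeight v L T X ω).toReal :=
  ENNReal.toReal_nonneg

/-- The real weight is in `[0, 1]`: the upper bound. [folklore] -/
theorem toReal_periodicFKWeight_le_one (v : ℝ → ℝ≥0∞) (L T : ℝ) (X : Config N) (ω : PathSpace N) :
    (periodicFKWeight v L T X ω).toReal ≤ 1 :=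
  ENNReal.toReal_le_of_le_ofReal zero_le_one (by simpa using periodicFKWeight_le_one v L T X ω)

open Classical in
/-- The real weight spelled out as `if A = ∞ then 0 else e^{-A}` with the action `A` over
`[0, t]`. [folklore] -/
theorem toReal_periodicFKWeight_eq (v : ℝ → ℝ≥0∞) (L t : ℝ) (X : Config N) (ω : PathSpace N) :
    (periodicFKWeight v L t X ω).toReal =
      if (∫⁻ s in Set.Icc 0 t, periodicInteraction v L (worldLine X ω s.toNNReal)) = ⊤ then (0 : ℝ)
      else Real.exp (-(∫⁻ s in Set.Icc 0 t,
        periodicInteraction v L (worldLine X ω s.toNNReal)).toReal) := by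
  rw [periodicFKWeight, toReal_expNeg, periodicPathAction_eq_lintegral_Icc]

/-! ### The path measure and the functional -/

/-- The weighted path measure is dominated by the Wiener measure. [folklore] -/
theorem periodicFKPathMeasure_le (v : ℝ → ℝ≥0∞) (L T : ℝ) (X : Config N) :
    periodicFKPathMeasure v L T X ≤ wienerPaths N := by
  calc periodicFKPathMeasure v L T X
      ≤ (wienerPaths N).withDensity 1 :=
        withDensity_mono (Eventually.of_forall fun ω => periodicFKWeight_le_one v L T X ω)
    _ = wienerPaths N := withDensity_one

/-- The weighted path measure is finite. [folklore] -/
instance isFiniteMeasure_periodicFKPathMeasure (v : ℝ → ℝ≥0∞) (L T : ℝ) (X : Config N) :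
    IsFiniteMeasure (periodicFKPathMeasure v L T X) :=
  isFiniteMeasure_of_le _ (periodicFKPathMeasure_le v L T X)

/-- The total mass of the weighted path measure is `(e^{-TH} 1)(X) ≤ 1`. [folklore] -/
theorem periodicFKPathMeasure_univ (v : ℝ → ℝ≥0∞) (L T : ℝ) (X : Config N) :
    periodicFKPathMeasure v L T X Set.univ = periodicFKSemigroup v L T (fun _ => 1) X := by
  rw [periodicFKPathMeasure, withDensity_apply _ MeasurableSet.univ, Measure.restrict_univ]
  simp [periodicFKSemigroup]

/-- The functional is bounded by `sup g` (sub-Markov: weights `≤ 1`, probability reference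
measure). [folklore] -/
theorem periodicFKSemigroup_le_iSup (v : ℝ → ℝ≥0∞) (L T : ℝ) (g : Config N → ℝ≥0∞)
    (X : Config N) : periodicFKSemigroup v L T g X ≤ ⨆ Y, g Y := by
  unfold periodicFKSemigroup
  calc ∫⁻ ω, periodicFKWeight v L T X ω * g (worldLine X ω T.toNNReal) ∂wienerPaths N
      ≤ ∫⁻ _ω, ⨆ Y, g Y ∂wienerPaths N := lintegral_mono fun ω => by
        calc periodicFKWeight v L T X ω * g (worldLine X ω T.toNNReal) ≤ 1 * ⨆ Y, g Y :=
              mul_le_mul' (periodicFKWeight_le_one v L T X ω) (le_iSup g _)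
          _ = ⨆ Y, g Y := one_mul _
    _ = ⨆ Y, g Y := by rw [lintegral_const, measure_univ, mul_one]

/-- In particular `(e^{-TH} 1)(X) ≤ 1`. [folklore] -/
theorem periodicFKSemigroup_one_le_one (v : ℝ → ℝ≥0∞) (L T : ℝ) (X : Config N) :
    periodicFKSemigroup v L T (fun _ => 1) X ≤ 1 :=
  (periodicFKSemigroup_le_iSup v L T _ X).trans (by simp)

/-- The functional is dominated by the free expectation `E[g(B_T)]` (drop the weight).
[folklore] -/
theorem periodicFKSemigroup_le_lintegral_worldLine (v : ℝ → ℝ≥0∞) (L T : ℝ)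
    (g : Config N → ℝ≥0∞) (X : Config N) :
    periodicFKSemigroup v L T g X ≤ ∫⁻ ω, g (worldLine X ω T.toNNReal) ∂wienerPaths N :=
  lintegral_mono fun ω =>
    (mul_le_mul' (periodicFKWeight_le_one v L T X ω) le_rfl).trans_eq (one_mul _)

/-- The functional is monotone in the observable. [folklore] -/
theorem periodicFKSemigroup_mono (v : ℝ → ℝ≥0∞) (L T : ℝ) {g g' : Config N → ℝ≥0∞} (h : g ≤ g')
    (X : Config N) : periodicFKSemigroup v L T g X ≤ periodicFKSemigroup v L T g' X :=
  lintegral_mono fun _ => mul_le_mul' le_rfl (h _)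

/-- For `T ≤ 0` the functional is the identity: `(e^{-0·H} g)(X) = g(X)` (no boundary, no
indicator). [folklore] -/
theorem periodicFKSemigroup_of_nonpos (v : ℝ → ℝ≥0∞) (L : ℝ) {T : ℝ} (hT : T ≤ 0)
    (g : Config N → ℝ≥0∞) (X : Config N) : periodicFKSemigroup v L T g X = g X := by
  simp [periodicFKSemigroup, periodicFKWeight_of_nonpos v L hT, Real.toNNReal_of_nonpos hT]

/-! ### Measurability of the action and the weight -/

/-- The action `ω ↦ ∫₀ᵀ ∑_{i<j} v^per(Bⁱ_s - Bʲ_s) ds` is measurable (Tonelli), for measurable `v`.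
[folklore] -/
theorem measurable_periodicPathAction {v : ℝ → ℝ≥0∞} (hv : Measurable v) (L T : ℝ)
    (X : Config N) : Measurable (periodicPathAction v L T X) :=
  ((measurable_periodicInteraction hv L).comp (measurable_worldLine_uncurry X)).lintegral_prod_right'

/-- The weight is measurable (for measurable `v`). [folklore] -/
theorem measurable_periodicFKWeight {v : ℝ → ℝ≥0∞} (hv : Measurable v) (L T : ℝ) (X : Config N) :
    Measurable (periodicFKWeight v L T X) :=
  measurable_expNeg.comp (measurable_periodicPathAction hv L T X)

/-- The world-lines are jointly measurable in (starting point, sample, real time). [folklore] -/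
theorem measurable_worldLine_prod :
    Measurable fun q : (Config N × PathSpace N) × ℝ => worldLine q.1.1 q.1.2 q.2.toNNReal := by
  have h : Measurable (Function.uncurry fun (s : ℝ) (p : Config N × PathSpace N) =>
      worldLine p.1 p.2 s.toNNReal) :=
    measurable_uncurry_of_continuous_of_measurable
      (fun p => continuous_worldLine_toNNReal p.1 p.2)
      (fun s => measurable_worldLine_uncurry' s.toNNReal)
  exact h.comp measurable_swap

/-- **Joint measurability of the action** in the starting point and the sample. [folklore] -/
theorem measurable_periodicPathAction_uncurry {v : ℝ → ℝ≥0∞} (hv : Measurable v) (L T : ℝ) :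
    Measurable fun p : Config N × PathSpace N => periodicPathAction v L T p.1 p.2 :=
  ((measurable_periodicInteraction hv L).comp measurable_worldLine_prod).lintegral_prod_right'

/-- **Joint measurability of the weight** `(X, ω) ↦ periodicFKWeight v L T X ω`. [folklore] -/
theorem measurable_periodicFKWeight_uncurry {v : ℝ → ℝ≥0∞} (hv : Measurable v) (L T : ℝ) :
    Measurable fun p : Config N × PathSpace N => periodicFKWeight v L T p.1 p.2 :=
  measurable_expNeg.comp (measurable_periodicPathAction_uncurry hv L T)

/-- **Measurability of the functional in the starting point**, for measurable `v` and `g`.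
[folklore] -/
theorem measurable_periodicFKSemigroup {v : ℝ → ℝ≥0∞} (hv : Measurable v) (L T : ℝ)
    {g : Config N → ℝ≥0∞} (hg : Measurable g) : Measurable (periodicFKSemigroup v L T g) := by
  have h : Measurable fun p : Config N × PathSpace N =>
      periodicFKWeight v L T p.1 p.2 * g (worldLine p.1 p.2 T.toNNReal) :=
    (measurable_periodicFKWeight_uncurry hv L T).mul
      (hg.comp (measurable_worldLine_uncurry' T.toNNReal))
  exact h.lintegral_prod_right'

/-- Integration against the weighted path measure is integration of `weight × integrand` against
the Wiener measure, for EVERY `[0, ∞]`-valued integrand. [folklore] -/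
theorem lintegral_periodicFKPathMeasure {v : ℝ → ℝ≥0∞} (hv : Measurable v) (L T : ℝ)
    (X : Config N) (f : PathSpace N → ℝ≥0∞) :
    ∫⁻ ω, f ω ∂periodicFKPathMeasure v L T X =
      ∫⁻ ω, periodicFKWeight v L T X ω * f ω ∂wienerPaths N :=
  lintegral_withDensity_eq_lintegral_mul_non_measurable _ (measurable_periodicFKWeight hv L T X)
    (Eventually.of_forall fun ω =>
      (periodicFKWeight_le_one v L T X ω).trans_lt ENNReal.one_lt_top) f

/-- The functional as an expectation under the weighted path measure. [folklore] -/
theorem periodicFKSemigroup_eq_lintegral_periodicFKPathMeasure {v : ℝ → ℝ≥0∞} (hv : Measurable v)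
    (L T : ℝ) (g : Config N → ℝ≥0∞) (X : Config N) :
    periodicFKSemigroup v L T g X =
      ∫⁻ ω, g (worldLine X ω T.toNNReal) ∂periodicFKPathMeasure v L T X := by
  rw [lintegral_periodicFKPathMeasure hv]
  rfl

/-- `periodicHeatFlow` as a Bochner integral against the weighted path measure (measurable `v`).
[folklore] -/
theorem periodicHeatFlow_eq_integral_periodicFKPathMeasure {v : ℝ → ℝ≥0∞} (hv : Measurable v)
    (L t : ℝ) (ψ₀ : Config N → ℂ) (X : Config N) :
    periodicHeatFlow v N L t ψ₀ X =
      ∫ ω, ψ₀ (worldLine X ω t.toNNReal) ∂periodicFKPathMeasure v L t X := by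
  rw [periodicFKPathMeasure, integral_withDensity_eq_integral_toReal_smul
    (measurable_periodicFKWeight hv L t X)
    (Eventually.of_forall fun ω =>
      (periodicFKWeight_le_one v L t X ω).trans_lt ENNReal.one_lt_top)]
  rfl

/-! ### Basic API of the flow -/

/-- For `t ≤ 0` the flow is the identity: `e^{-0·H}ψ₀ = ψ₀` (and the junk extension to `t < 0`).
[folklore] -/
theorem periodicHeatFlow_of_nonpos (v : ℝ → ℝ≥0∞) (L : ℝ) {t : ℝ} (ht : t ≤ 0)
    (ψ₀ : Config N → ℂ) : periodicHeatFlow v N L t ψ₀ = ψ₀ := by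
  funext X
  simp [periodicHeatFlow, periodicFKWeight_of_nonpos v L ht, Real.toNNReal_of_nonpos ht]

/-- `e^{-0·H} ψ₀ = ψ₀`. [folklore] -/
theorem periodicHeatFlow_zero (v : ℝ → ℝ≥0∞) (L : ℝ) (ψ₀ : Config N → ℂ) :
    periodicHeatFlow v N L 0 ψ₀ = ψ₀ :=
  periodicHeatFlow_of_nonpos v L le_rfl ψ₀

/-- Homogeneity: `e^{-tH}(c ψ₀) = c · e^{-tH}ψ₀`. [folklore] -/
theorem periodicHeatFlow_smul (v : ℝ → ℝ≥0∞) (L t : ℝ) (c : ℂ) (ψ₀ : Config N → ℂ) :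
    periodicHeatFlow v N L t (c • ψ₀) = c • periodicHeatFlow v N L t ψ₀ := by
  funext X
  simp only [periodicHeatFlow_eq, Pi.smul_apply, smul_comm _ c, integral_smul]

/-- `e^{-tH}(-ψ₀) = -e^{-tH}ψ₀`. [folklore] -/
theorem periodicHeatFlow_neg (v : ℝ → ℝ≥0∞) (L t : ℝ) (ψ₀ : Config N → ℂ) :
    periodicHeatFlow v N L t (-ψ₀) = -periodicHeatFlow v N L t ψ₀ := by
  rw [← neg_one_smul ℂ ψ₀, periodicHeatFlow_smul, neg_one_smul]

/-- Additivity at a point where both integrands are integrable (always the case for bounded data,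
`integrable_periodicFKWeight_smul`). [folklore] -/
theorem periodicHeatFlow_add_apply (v : ℝ → ℝ≥0∞) (L t : ℝ) {ψ φ : Config N → ℂ} {X : Config N}
    (hψ : Integrable (fun ω => (periodicFKWeight v L t X ω).toReal • ψ (worldLine X ω t.toNNReal))
      (wienerPaths N))
    (hφ : Integrable (fun ω => (periodicFKWeight v L t X ω).toReal • φ (worldLine X ω t.toNNReal))
      (wienerPaths N)) :
    periodicHeatFlow v N L t (ψ + φ) X = periodicHeatFlow v N L t ψ X + periodicHeatFlow v N L t φ X := by
  simp only [periodicHeatFlow_eq, Pi.add_apply, smul_add]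
  exact integral_add hψ hφ

/-- Bounded measurable data have integrable Feynman–Kac integrands (measurable `v`).
[folklore] -/
theorem integrable_periodicFKWeight_smul {v : ℝ → ℝ≥0∞} (hv : Measurable v) (L t : ℝ)
    {ψ₀ : Config N → ℂ} (hψ : Measurable ψ₀) {C : ℝ} (hC : ∀ Y, ‖ψ₀ Y‖ ≤ C) (X : Config N) :
    Integrable (fun ω => (periodicFKWeight v L t X ω).toReal • ψ₀ (worldLine X ω t.toNNReal))
      (wienerPaths N) := by
  refine Integrable.mono' (integrable_const C) ?_ (Eventually.of_forall fun ω => ?_)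
  · exact ((measurable_periodicFKWeight hv L t X).ennreal_toReal.smul
      (hψ.comp (measurable_worldLine X _))).aestronglyMeasurable
  · rw [norm_smul, Real.norm_of_nonneg (toReal_periodicFKWeight_nonneg v L t X ω)]
    exact (mul_le_of_le_one_left (norm_nonneg _) (toReal_periodicFKWeight_le_one v L t X ω)).trans
      (hC _)

/-- Additivity of the flow on bounded measurable data (measurable `v`). [folklore] -/
theorem periodicHeatFlow_add_of_bounded {v : ℝ → ℝ≥0∞} (hv : Measurable v) (L t : ℝ)
    {φ₁ φ₂ : Config N → ℂ} (h₁ : Measurable φ₁) (h₂ : Measurable φ₂) {C₁ C₂ : ℝ}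
    (hb₁ : ∀ Y, ‖φ₁ Y‖ ≤ C₁) (hb₂ : ∀ Y, ‖φ₂ Y‖ ≤ C₂) :
    periodicHeatFlow v N L t (φ₁ + φ₂) =
      periodicHeatFlow v N L t φ₁ + periodicHeatFlow v N L t φ₂ := by
  funext X
  exact periodicHeatFlow_add_apply v L t (integrable_periodicFKWeight_smul hv L t h₁ hb₁ X)
    (integrable_periodicFKWeight_smul hv L t h₂ hb₂ X)

/-- Subtractivity of the flow on bounded measurable data (measurable `v`). [folklore] -/
theorem periodicHeatFlow_sub_of_bounded {v : ℝ → ℝ≥0∞} (hv : Measurable v) (L t : ℝ)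
    {φ₁ φ₂ : Config N → ℂ} (h₁ : Measurable φ₁) (h₂ : Measurable φ₂) {C₁ C₂ : ℝ}
    (hb₁ : ∀ Y, ‖φ₁ Y‖ ≤ C₁) (hb₂ : ∀ Y, ‖φ₂ Y‖ ≤ C₂) :
    periodicHeatFlow v N L t (φ₁ - φ₂) =
      periodicHeatFlow v N L t φ₁ - periodicHeatFlow v N L t φ₂ := by
  rw [sub_eq_add_neg, periodicHeatFlow_add_of_bounded hv L t h₁ h₂.neg hb₁
    (fun Y => by rw [Pi.neg_apply, norm_neg]; exact hb₂ Y), periodicHeatFlow_neg, ← sub_eq_add_neg]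

/-- Complex conjugation commutes with the flow (the weights are real). [folklore] -/
theorem periodicHeatFlow_conj (v : ℝ → ℝ≥0∞) (L t : ℝ) (ψ₀ : Config N → ℂ) (X : Config N) :
    periodicHeatFlow v N L t (fun Y => conj (ψ₀ Y)) X = conj (periodicHeatFlow v N L t ψ₀ X) := by
  simp only [periodicHeatFlow_eq, ← integral_conj, Complex.real_smul, map_mul, Complex.conj_ofReal]

/-- **Real data stay real**: on real-valued data the flow is the real Wiener expectation
`E[weight · f(B_t)]`. [folklore] -/
theorem periodicHeatFlow_ofReal (v : ℝ → ℝ≥0∞) (L t : ℝ) (f : Config N → ℝ) (X : Config N) :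
    periodicHeatFlow v N L t (fun Y => (f Y : ℂ)) X =
      ((∫ ω, (periodicFKWeight v L t X ω).toReal * f (worldLine X ω t.toNNReal) ∂wienerPaths N :
        ℝ) : ℂ) := by
  simp only [periodicHeatFlow_eq, Complex.real_smul, ← Complex.ofReal_mul, integral_complex_ofReal]

/-- **Positivity preservation**: nonnegative data stay nonnegative. [folklore] -/
theorem periodicHeatFlow_ofReal_nonneg (v : ℝ → ℝ≥0∞) (L t : ℝ) {f : Config N → ℝ}
    (hf : ∀ Y, 0 ≤ f Y) (X : Config N) :
    0 ≤ (periodicHeatFlow v N L t (fun Y => (f Y : ℂ)) X).re := by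
  rw [periodicHeatFlow_ofReal, Complex.ofReal_re]
  exact integral_nonneg fun ω => mul_nonneg (toReal_periodicFKWeight_nonneg v L t X ω) (hf _)

/-- **Nonnegative data: the flow is the `[0,∞]`-valued functional** `periodicFKSemigroup` (read
back in `ℝ`; both sides are `0` when the functional is infinite). [folklore] -/
theorem periodicHeatFlow_ofReal_eq_periodicFKSemigroup {v : ℝ → ℝ≥0∞} (hv : Measurable v)
    (L t : ℝ) {f : Config N → ℝ} (hf : Measurable f) (h0 : ∀ Y, 0 ≤ f Y) (X : Config N) :
    periodicHeatFlow v N L t (fun Y => (f Y : ℂ)) X =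
      ((periodicFKSemigroup v L t (fun Y => ENNReal.ofReal (f Y)) X).toReal : ℂ) := by
  rw [periodicHeatFlow_ofReal]
  congr 1
  rw [integral_eq_lintegral_of_nonneg_ae
    (Eventually.of_forall fun ω => mul_nonneg (toReal_periodicFKWeight_nonneg v L t X ω) (h0 _))
    (((measurable_periodicFKWeight hv L t X).ennreal_toReal.mul
      (hf.comp (measurable_worldLine X _))).aestronglyMeasurable)]
  congr 1
  refine lintegral_congr fun ω => ?_
  rw [ENNReal.ofReal_mul (toReal_periodicFKWeight_nonneg v L t X ω),
    ENNReal.ofReal_toReal (periodicFKWeight_ne_top v L t X ω)]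

/-- **Pointwise domination by the flow of the modulus**:
`‖(e^{-tH}ψ₀)(X)‖ₑ ≤ (e^{-tH}‖ψ₀‖)(X)`. [folklore] -/
theorem enorm_periodicHeatFlow_le_periodicFKSemigroup (v : ℝ → ℝ≥0∞) (L t : ℝ)
    (ψ₀ : Config N → ℂ) (X : Config N) :
    ‖periodicHeatFlow v N L t ψ₀ X‖ₑ ≤ periodicFKSemigroup v L t (fun Y => ‖ψ₀ Y‖ₑ) X := by
  refine (enorm_integral_le_lintegral_enorm _).trans (lintegral_mono fun ω => ?_)
  rw [enorm_smul, Real.enorm_eq_ofReal (toReal_periodicFKWeight_nonneg v L t X ω),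
    ENNReal.ofReal_toReal (periodicFKWeight_ne_top v L t X ω)]

/-- **Sup bound** (sub-Markov property): `‖(e^{-tH}ψ₀)(X)‖ ≤ sup ‖ψ₀‖`. [folklore] -/
theorem norm_periodicHeatFlow_le (v : ℝ → ℝ≥0∞) (L t : ℝ) {ψ₀ : Config N → ℂ} {C : ℝ}
    (hC : ∀ Y, ‖ψ₀ Y‖ ≤ C) (X : Config N) : ‖periodicHeatFlow v N L t ψ₀ X‖ ≤ C := by
  have h := norm_integral_le_of_norm_le_const (μ := wienerPaths N) (C := C)
    (f := fun ω => (periodicFKWeight v L t X ω).toReal • ψ₀ (worldLine X ω t.toNNReal))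
    (Eventually.of_forall fun ω => by
      rw [norm_smul, Real.norm_of_nonneg (toReal_periodicFKWeight_nonneg v L t X ω)]
      exact (mul_le_of_le_one_left (norm_nonneg _)
        (toReal_periodicFKWeight_le_one v L t X ω)).trans (hC _))
  simpa [periodicHeatFlow_eq] using h

/-! ### Measurability of the flow; null modifications of the data -/

/-- The complex Feynman–Kac integrand `(X, ω) ↦ weight · ψ₀(B_t)` is jointly measurable, for
measurable `v` and `ψ₀`. [folklore] -/
theorem measurable_periodicFKWeight_smul_uncurry {v : ℝ → ℝ≥0∞} (hv : Measurable v) (L t : ℝ)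
    {ψ₀ : Config N → ℂ} (hψ : Measurable ψ₀) :
    Measurable fun p : Config N × PathSpace N =>
      (periodicFKWeight v L t p.1 p.2).toReal • ψ₀ (worldLine p.1 p.2 t.toNNReal) :=
  (measurable_periodicFKWeight_uncurry hv L t).ennreal_toReal.smul
    (hψ.comp (measurable_worldLine_uncurry' _))

/-- **`periodicHeatFlow v N L t ψ₀` is (strongly) measurable** for measurable `v` and `ψ₀`.
[folklore] -/
theorem stronglyMeasurable_periodicHeatFlow {v : ℝ → ℝ≥0∞} (hv : Measurable v) (L t : ℝ)
    {ψ₀ : Config N → ℂ} (hψ : Measurable ψ₀) :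
    StronglyMeasurable (periodicHeatFlow v N L t ψ₀) :=
  (measurable_periodicFKWeight_smul_uncurry hv L t hψ).stronglyMeasurable.integral_prod_right'

/-- `periodicHeatFlow v N L t ψ₀` is measurable for measurable `v` and `ψ₀`. [folklore] -/
@[fun_prop]
theorem measurable_periodicHeatFlow {v : ℝ → ℝ≥0∞} (hv : Measurable v) (L t : ℝ)
    {ψ₀ : Config N → ℂ} (hψ : Measurable ψ₀) : Measurable (periodicHeatFlow v N L t ψ₀) :=
  (stronglyMeasurable_periodicHeatFlow hv L t hψ).measurable

/-- **A null modification of the data does not change the flow at any point** (`t > 0`: the law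
of `B_t` is absolutely continuous). [folklore] -/
theorem periodicHeatFlow_congr_ae (v : ℝ → ℝ≥0∞) (L : ℝ) {t : ℝ} (ht : 0 < t)
    {ψ ψ' : Config N → ℂ} (h : ψ =ᵐ[volume] ψ') :
    periodicHeatFlow v N L t ψ = periodicHeatFlow v N L t ψ' := by
  funext X
  refine integral_congr_ae ?_
  filter_upwards [comp_worldLine_ae_eq X (t := t.toNNReal) (by simpa using ht) h] with ω hω
  rw [hω]

/-! ### Covariance under translations; periodic data stay periodic -/

/-- World-lines of translated starting points: `B_s(X + A, ω) = B_s(X, ω) + A`. [folklore] -/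
theorem worldLine_add_right (X A : Config N) (ω : PathSpace N) (s : ℝ≥0) :
    worldLine (X + A) ω s = worldLine X ω s + A := by
  rw [worldLine_eq_add, worldLine_eq_add, add_right_comm]

/-- The periodised action is invariant under translating one particle by a period `L e_k`.
[folklore] -/
theorem periodicPathAction_add_single (v : ℝ → ℝ≥0∞) (L T : ℝ) (X : Config N) (i : Fin N)
    (k : Fin 3) (ω : PathSpace N) :
    periodicPathAction v L T (X + Pi.single i (EuclideanSpace.single k L)) ω =
      periodicPathAction v L T X ω := by
  simp only [periodicPathAction, worldLine_add_right, periodicInteraction_add_single]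

/-- The periodised action is invariant under a common translation of all particles. [folklore] -/
theorem periodicPathAction_add_const (v : ℝ → ℝ≥0∞) (L T : ℝ) (X : Config N) (u : Space)
    (ω : PathSpace N) :
    periodicPathAction v L T (X + fun _ => u) ω = periodicPathAction v L T X ω := by
  simp only [periodicPathAction, worldLine_add_right, periodicInteraction_add_const]

/-- The weight is invariant under translating one particle by a period. [folklore] -/
theorem periodicFKWeight_add_single (v : ℝ → ℝ≥0∞) (L T : ℝ) (X : Config N) (i : Fin N)
    (k : Fin 3) (ω : PathSpace N) :
    periodicFKWeight v L T (X + Pi.single i (EuclideanSpace.single k L)) ω =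
      periodicFKWeight v L T X ω := by
  rw [periodicFKWeight, periodicFKWeight, periodicPathAction_add_single]

/-- The weight is invariant under a common translation of all particles. [folklore] -/
theorem periodicFKWeight_add_const (v : ℝ → ℝ≥0∞) (L T : ℝ) (X : Config N) (u : Space)
    (ω : PathSpace N) :
    periodicFKWeight v L T (X + fun _ => u) ω = periodicFKWeight v L T X ω := by
  rw [periodicFKWeight, periodicFKWeight, periodicPathAction_add_const]

/-- **Covariance under a lattice translation of one particle**:
`(e^{-tH}ψ₀)(X + L e_{i,k}) = (e^{-tH} ψ₀(· + L e_{i,k}))(X)`. [folklore] -/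
theorem periodicHeatFlow_add_single (v : ℝ → ℝ≥0∞) (L t : ℝ) (ψ₀ : Config N → ℂ) (X : Config N)
    (i : Fin N) (k : Fin 3) :
    periodicHeatFlow v N L t ψ₀ (X + Pi.single i (EuclideanSpace.single k L)) =
      periodicHeatFlow v N L t (fun Y => ψ₀ (Y + Pi.single i (EuclideanSpace.single k L))) X := by
  simp only [periodicHeatFlow_eq, periodicFKWeight_add_single, worldLine_add_right]

/-- **Covariance under a common translation of all particles** (momentum conservation):
`(e^{-tH}ψ₀)(X + (u, …, u)) = (e^{-tH} ψ₀(· + (u, …, u)))(X)`. [folklore] -/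
theorem periodicHeatFlow_add_const (v : ℝ → ℝ≥0∞) (L t : ℝ) (ψ₀ : Config N → ℂ) (X : Config N)
    (u : Space) :
    periodicHeatFlow v N L t ψ₀ (X + fun _ => u) =
      periodicHeatFlow v N L t (fun Y => ψ₀ (Y + fun _ => u)) X := by
  simp only [periodicHeatFlow_eq, periodicFKWeight_add_const, worldLine_add_right]

/-- **Periodic data stay periodic**: if `ψ₀` is `Lℤ³`-periodic in every particle (stated on the
generators `L e_{i,k}`), so is `e^{-tH}ψ₀`. [folklore] -/
theorem periodicHeatFlow_add_single_of_periodic (v : ℝ → ℝ≥0∞) (L t : ℝ) {ψ₀ : Config N → ℂ}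
    (hψ : ∀ (Y : Config N) (i : Fin N) (k : Fin 3),
      ψ₀ (Y + Pi.single i (EuclideanSpace.single k L)) = ψ₀ Y)
    (X : Config N) (i : Fin N) (k : Fin 3) :
    periodicHeatFlow v N L t ψ₀ (X + Pi.single i (EuclideanSpace.single k L)) =
      periodicHeatFlow v N L t ψ₀ X := by
  rw [periodicHeatFlow_add_single]
  simp only [hψ]

/-- The `[0,∞]`-valued functional is covariant under lattice translations of one particle.
[folklore] -/
theorem periodicFKSemigroup_add_single (v : ℝ → ℝ≥0∞) (L T : ℝ) (g : Config N → ℝ≥0∞)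
    (X : Config N) (i : Fin N) (k : Fin 3) :
    periodicFKSemigroup v L T g (X + Pi.single i (EuclideanSpace.single k L)) =
      periodicFKSemigroup v L T (fun Y => g (Y + Pi.single i (EuclideanSpace.single k L))) X := by
  simp only [periodicFKSemigroup, periodicFKWeight_add_single, worldLine_add_right]

/-! ### Bose symmetry: relabelling the particles commutes with the flow -/

/-- The periodised potential is even: `v^per(-z) = v^per(z)` (reindex the lattice sum by
`n ↦ -n`). (Local copy of `periodizedPotential_neg` of `PeriodicBoseGasTagged.lean`, whose import
cone clashes with `DiluteBoseGasUpperBoundLocalization.lean`.) [folklore] -/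
private theorem periodizedPotential_neg_aux (v : ℝ → ℝ≥0∞) (L : ℝ) (z : Space) :
    periodizedPotential v L (-z) = periodizedPotential v L z := by
  unfold periodizedPotential
  rw [← (Equiv.neg (Fin 3 → ℤ)).tsum_eq]
  refine tsum_congr fun n => ?_
  rw [Equiv.neg_apply, latticeVec_neg, sub_neg_eq_add, ← norm_neg, neg_add, neg_neg,
    sub_eq_add_neg]

/-- The sum over ordered pairs of distinct particles is twice the periodic interaction:
`∑_{i ≠ j} v^per(xᵢ - xⱼ) = 2 ∑_{i<j} v^per(xᵢ - xⱼ)` (evenness of `v^per`). [folklore] -/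
theorem sum_sum_ne_eq_two_mul_periodicInteraction (v : ℝ → ℝ≥0∞) (L : ℝ) (X : Config N) :
    ∑ i : Fin N, ∑ j : Fin N with j ≠ i, periodizedPotential v L (X i - X j) =
      2 * periodicInteraction v L X := by
  unfold periodicInteraction
  have hsplit : ∀ i : Fin N, (∑ j : Fin N with j ≠ i, periodizedPotential v L (X i - X j)) =
      (∑ j : Fin N with i < j, periodizedPotential v L (X i - X j)) +
        ∑ j : Fin N with j < i, periodizedPotential v L (X i - X j) := by
    intro i
    rw [← Finset.sum_union]
    · congr 1
      ext j
      simp only [Finset.mem_filter, Finset.mem_univ, true_and, Finset.mem_union]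
      exact ⟨fun h => (lt_or_gt_of_ne h).symm, fun h => h.elim ne_of_gt ne_of_lt⟩
    · rw [Finset.disjoint_filter]
      intro j _ h1 h2
      exact lt_asymm h1 h2
  simp only [hsplit, Finset.sum_add_distrib, two_mul]
  congr 1
  rw [Finset.sum_comm' (t' := Finset.univ) (s' := fun j => Finset.univ.filter fun i => j < i)]
  · refine Finset.sum_congr rfl fun j _ => Finset.sum_congr rfl fun i _ => ?_
    rw [← periodizedPotential_neg_aux, neg_sub]
  · intro i j
    simp

/-- **The periodic interaction is invariant under relabelling the particles.** [folklore] -/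
theorem periodicInteraction_comp_equiv {m n : ℕ} (v : ℝ → ℝ≥0∞) (L : ℝ) (e : Fin m ≃ Fin n)
    (X : Config n) : periodicInteraction v L (fun a => X (e a)) = periodicInteraction v L X := by
  have h2 : (2 : ℝ≥0∞) ≠ 0 := two_ne_zero
  rw [← ENNReal.mul_right_inj h2 ENNReal.ofNat_ne_top,
    ← sum_sum_ne_eq_two_mul_periodicInteraction, ← sum_sum_ne_eq_two_mul_periodicInteraction,
    ← e.sum_comp]
  refine Finset.sum_congr rfl fun a _ => ?_
  rw [Finset.sum_filter, Finset.sum_filter, ← e.sum_comp]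
  refine Finset.sum_congr rfl fun b _ => ?_
  simp only [ne_eq, e.apply_eq_iff_eq]

/-- The periodic weight is relabelling invariant. [folklore] -/
theorem periodicFKWeight_comp_perm (v : ℝ → ℝ≥0∞) (L T : ℝ) (σ : Equiv.Perm (Fin N))
    (X : Config N) (ω : PathSpace N) :
    periodicFKWeight v L T (X ∘ σ) (permPaths σ ω) = periodicFKWeight v L T X ω := by
  simp only [periodicFKWeight, periodicPathAction, worldLine_comp_perm]
  congr 1
  refine lintegral_congr fun s => ?_
  exact periodicInteraction_comp_equiv v L σ _

/-- **Relabelling the particles commutes with the flow**: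
`(e^{-tH}ψ₀)(X ∘ σ) = (e^{-tH}(ψ₀ ∘ (· ∘ σ)))(X)`. [folklore] -/
theorem periodicHeatFlow_comp_perm (v : ℝ → ℝ≥0∞) (L t : ℝ) (ψ₀ : Config N → ℂ)
    (σ : Equiv.Perm (Fin N)) (X : Config N) :
    periodicHeatFlow v N L t ψ₀ (X ∘ σ) = periodicHeatFlow v N L t (fun Y => ψ₀ (Y ∘ σ)) X := by
  rw [periodicHeatFlow_eq, periodicHeatFlow_eq,
    ← (measurePreserving_permPaths σ).integral_comp' (f := permPaths σ)]
  refine integral_congr_ae (Eventually.of_forall fun ω => ?_)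
  simp only [periodicFKWeight_comp_perm, worldLine_comp_perm]

/-- **Bose symmetry is preserved**: permutation-symmetric data flow to permutation-symmetric
functions. [folklore] -/
theorem periodicHeatFlow_perm_of_symm (v : ℝ → ℝ≥0∞) (L t : ℝ) {ψ₀ : Config N → ℂ}
    (hsymm : ∀ (σ : Equiv.Perm (Fin N)) (Y : Config N), ψ₀ (Y ∘ σ) = ψ₀ Y)
    (σ : Equiv.Perm (Fin N)) (X : Config N) :
    periodicHeatFlow v N L t ψ₀ (X ∘ σ) = periodicHeatFlow v N L t ψ₀ X := by
  rw [periodicHeatFlow_comp_perm]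
  simp only [hsymm]

/-- The `[0,∞]`-valued functional is relabelling covariant. [folklore] -/
theorem periodicFKSemigroup_comp_perm (v : ℝ → ℝ≥0∞) (L T : ℝ) (g : Config N → ℝ≥0∞)
    (σ : Equiv.Perm (Fin N)) (X : Config N) :
    periodicFKSemigroup v L T g (X ∘ σ) = periodicFKSemigroup v L T (fun Y => g (Y ∘ σ)) X := by
  rw [periodicFKSemigroup, periodicFKSemigroup,
    ← (measurePreserving_permPaths σ).lintegral_comp_emb (permPaths σ).measurableEmbedding]
  refine lintegral_congr fun ω => ?_
  simp only [periodicFKWeight_comp_perm, worldLine_comp_perm]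

/-! ### `L²` and `L¹` bounds: whole space and the fundamental cell -/

/-- **The adjoint is sub-Markov on `(ℝ³)^N`**: `∫ (e^{-TH} G)(X) dX ≤ ∫ G` for every measurable
`G ≥ 0` (drop the weight, Tonelli, translation invariance of Lebesgue measure). [folklore] -/
theorem lintegral_periodicFKSemigroup_le {v : ℝ → ℝ≥0∞} (L T : ℝ) {G : Config N → ℝ≥0∞}
    (hG : Measurable G) : ∫⁻ X, periodicFKSemigroup v L T G X ≤ ∫⁻ X, G X := by
  calc ∫⁻ X, periodicFKSemigroup v L T G X
      ≤ ∫⁻ X, ∫⁻ ω, G (worldLine X ω T.toNNReal) ∂wienerPaths N :=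
        lintegral_mono fun X => periodicFKSemigroup_le_lintegral_worldLine v L T G X
    _ = ∫⁻ ω, ∫⁻ X, G (worldLine X ω T.toNNReal) ∂volume ∂wienerPaths N :=
        lintegral_lintegral_swap ((hG.comp (measurable_worldLine_uncurry' _)).aemeasurable)
    _ = ∫⁻ ω, ∫⁻ X, G X ∂volume ∂wienerPaths N := by
        refine lintegral_congr fun ω => ?_
        simp only [worldLine_eq_add _ ω]
        exact lintegral_add_right_eq_self G _
    _ = ∫⁻ X, G X := by rw [lintegral_const, measure_univ, mul_one]

/-- **The adjoint is sub-Markov on the torus**: for `G ≥ 0` measurable and `Lℤ³`-periodic in every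
particle, `∫_{[0,L)^{3N}} (e^{-TH} G)(X) dX ≤ ∫_{[0,L)^{3N}} G` (drop the weight, Tonelli, and the
shift invariance of cell integrals of periodic functions: `[0,L)^{3N}` and its translates are
fundamental domains of `(Lℤ³)^N`). [folklore] -/
theorem setLIntegral_cellN_periodicFKSemigroup_le {v : ℝ → ℝ≥0∞} {L : ℝ} (hL : 0 < L) (T : ℝ)
    {G : Config N → ℝ≥0∞} (hG : Measurable G)
    (hper : ∀ (X : Config N) (i : Fin N) (k : Fin 3),
      G (X + Pi.single i (EuclideanSpace.single k L)) = G X) :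
    ∫⁻ X in cellN N L, periodicFKSemigroup v L T G X ≤ ∫⁻ X in cellN N L, G X := by
  calc ∫⁻ X in cellN N L, periodicFKSemigroup v L T G X
      ≤ ∫⁻ X in cellN N L, ∫⁻ ω, G (worldLine X ω T.toNNReal) ∂wienerPaths N :=
        lintegral_mono fun X => periodicFKSemigroup_le_lintegral_worldLine v L T G X
    _ = ∫⁻ ω, ∫⁻ X in cellN N L, G (worldLine X ω T.toNNReal) ∂volume ∂wienerPaths N :=
        lintegral_lintegral_swap ((hG.comp (measurable_worldLine_uncurry' _)).aemeasurable)
    _ = ∫⁻ ω, ∫⁻ X in cellN N L, G X ∂volume ∂wienerPaths N := by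
        refine lintegral_congr fun ω => ?_
        simp only [worldLine_eq_add _ ω]
        exact lintegral_cellN_comp_add hL hper _
    _ = ∫⁻ X in cellN N L, G X := by rw [lintegral_const, measure_univ, mul_one]

/-- **`L¹`-type bound on `(ℝ³)^N`**: `∫ ‖e^{-tH}ψ₀‖ ≤ ∫ ‖ψ₀‖`. [folklore] -/
theorem lintegral_enorm_periodicHeatFlow_le (v : ℝ → ℝ≥0∞) (L t : ℝ) {ψ₀ : Config N → ℂ}
    (hψ : Measurable ψ₀) : ∫⁻ X, ‖periodicHeatFlow v N L t ψ₀ X‖ₑ ≤ ∫⁻ X, ‖ψ₀ X‖ₑ :=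
  (lintegral_mono fun X => enorm_periodicHeatFlow_le_periodicFKSemigroup v L t ψ₀ X).trans
    (lintegral_periodicFKSemigroup_le L t hψ.enorm)

/-- **`L¹`-type bound on the cell** for periodic data: `∫_cell ‖e^{-tH}ψ₀‖ ≤ ∫_cell ‖ψ₀‖`.
[folklore] -/
theorem setLIntegral_cellN_enorm_periodicHeatFlow_le (v : ℝ → ℝ≥0∞) {L : ℝ} (hL : 0 < L) (t : ℝ)
    {ψ₀ : Config N → ℂ} (hψ : Measurable ψ₀)
    (hper : ∀ (Y : Config N) (i : Fin N) (k : Fin 3),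
      ψ₀ (Y + Pi.single i (EuclideanSpace.single k L)) = ψ₀ Y) :
    ∫⁻ X in cellN N L, ‖periodicHeatFlow v N L t ψ₀ X‖ₑ ≤ ∫⁻ X in cellN N L, ‖ψ₀ X‖ₑ :=
  (lintegral_mono fun X => enorm_periodicHeatFlow_le_periodicFKSemigroup v L t ψ₀ X).trans
    (setLIntegral_cellN_periodicFKSemigroup_le hL t hψ.enorm fun Y i k => by rw [hper])

/-- **Jensen under the weighted path measure**: `‖(e^{-tH}ψ₀)(X)‖ₑ² ≤ (e^{-tH}‖ψ₀‖²)(X)`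
(Cauchy–Schwarz against the sub-probability measure `periodicFKPathMeasure`). [folklore] -/
theorem enorm_periodicHeatFlow_sq_le_periodicFKSemigroup {v : ℝ → ℝ≥0∞} (hv : Measurable v)
    (L t : ℝ) {ψ₀ : Config N → ℂ} (hψ : Measurable ψ₀) (X : Config N) :
    ‖periodicHeatFlow v N L t ψ₀ X‖ₑ ^ 2 ≤
      periodicFKSemigroup v L t (fun Y => ‖ψ₀ Y‖ₑ ^ 2) X := by
  set μ := periodicFKPathMeasure v L t X with hμ
  set a : PathSpace N → ℝ≥0∞ := fun ω => ‖ψ₀ (worldLine X ω t.toNNReal)‖ₑ with ha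
  have ham : AEMeasurable a μ := (hψ.comp (measurable_worldLine X _)).enorm.aemeasurable
  have hμ1 : μ Set.univ ≤ 1 := by
    rw [hμ, periodicFKPathMeasure_univ]; exact periodicFKSemigroup_one_le_one v L t X
  have h1 : ‖periodicHeatFlow v N L t ψ₀ X‖ₑ ≤ ∫⁻ ω, a ω ∂μ := by
    rw [periodicHeatFlow_eq_integral_periodicFKPathMeasure hv]
    exact enorm_integral_le_lintegral_enorm _
  have h2 : ∫⁻ ω, a ω ∂μ ≤ (∫⁻ ω, a ω ^ 2 ∂μ) ^ (1 / 2 : ℝ) := by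
    have hcs := ENNReal.lintegral_mul_le_Lp_mul_Lq μ Real.HolderConjugate.two_two ham
      aemeasurable_const (g := fun _ => 1)
    simp only [Pi.mul_apply, mul_one, ENNReal.one_rpow, lintegral_const, one_mul] at hcs
    refine hcs.trans ?_
    calc (∫⁻ ω, a ω ^ (2 : ℝ) ∂μ) ^ (1 / (2 : ℝ)) * μ Set.univ ^ (1 / (2 : ℝ))
        ≤ (∫⁻ ω, a ω ^ (2 : ℝ) ∂μ) ^ (1 / (2 : ℝ)) * 1 :=
          mul_le_mul' le_rfl (by simpa using ENNReal.rpow_le_rpow hμ1 (by norm_num : (0:ℝ) ≤ 1/2))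
      _ = (∫⁻ ω, a ω ^ 2 ∂μ) ^ (1 / 2 : ℝ) := by
          rw [mul_one]; simp_rw [ENNReal.rpow_two]
  calc ‖periodicHeatFlow v N L t ψ₀ X‖ₑ ^ 2
      ≤ ((∫⁻ ω, a ω ^ 2 ∂μ) ^ (1 / 2 : ℝ)) ^ 2 := pow_le_pow_left' (h1.trans h2) 2
    _ = ∫⁻ ω, a ω ^ 2 ∂μ := by
        rw [← ENNReal.rpow_two, ← ENNReal.rpow_mul]; norm_num
    _ = periodicFKSemigroup v L t (fun Y => ‖ψ₀ Y‖ₑ ^ 2) X := by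
        rw [hμ, lintegral_periodicFKPathMeasure hv]; rfl

/-- **`L²`-contraction on `(ℝ³)^N`**: `∫ ‖e^{-tH}ψ₀‖² ≤ ∫ ‖ψ₀‖²` (measurable `v`, `ψ₀`).
[folklore] -/
theorem lintegral_enorm_periodicHeatFlow_sq_le {v : ℝ → ℝ≥0∞} (hv : Measurable v) (L t : ℝ)
    {ψ₀ : Config N → ℂ} (hψ : Measurable ψ₀) :
    ∫⁻ X, ‖periodicHeatFlow v N L t ψ₀ X‖ₑ ^ 2 ≤ ∫⁻ X, ‖ψ₀ X‖ₑ ^ 2 :=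
  (lintegral_mono fun X => enorm_periodicHeatFlow_sq_le_periodicFKSemigroup hv L t hψ X).trans
    (lintegral_periodicFKSemigroup_le L t (hψ.enorm.pow_const 2))

/-- **`L²`-contraction of the torus heat flow on the fundamental cell**: for measurable `v`,
`L > 0` and measurable data `ψ₀` that are `Lℤ³`-periodic in every particle,
`∫_{[0,L)^{3N}} ‖e^{-tH}ψ₀‖² ≤ ∫_{[0,L)^{3N}} ‖ψ₀‖²` (any `t`). [folklore] -/
theorem setLIntegral_cellN_enorm_periodicHeatFlow_sq_le {v : ℝ → ℝ≥0∞} (hv : Measurable v)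
    {L : ℝ} (hL : 0 < L) (t : ℝ) {ψ₀ : Config N → ℂ} (hψ : Measurable ψ₀)
    (hper : ∀ (Y : Config N) (i : Fin N) (k : Fin 3),
      ψ₀ (Y + Pi.single i (EuclideanSpace.single k L)) = ψ₀ Y) :
    ∫⁻ X in cellN N L, ‖periodicHeatFlow v N L t ψ₀ X‖ₑ ^ 2 ≤ ∫⁻ X in cellN N L, ‖ψ₀ X‖ₑ ^ 2 :=
  (lintegral_mono fun X => enorm_periodicHeatFlow_sq_le_periodicFKSemigroup hv L t hψ X).trans
    (setLIntegral_cellN_periodicFKSemigroup_le hL t (hψ.enorm.pow_const 2) fun Y i k => by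
      rw [hper])

/-- The cell contraction in `eLpNorm` form: `‖e^{-tH}ψ₀‖_{L²(cell)} ≤ ‖ψ₀‖_{L²(cell)}` for periodic
measurable data. [folklore] -/
theorem eLpNorm_cellN_periodicHeatFlow_le {v : ℝ → ℝ≥0∞} (hv : Measurable v) {L : ℝ} (hL : 0 < L)
    (t : ℝ) {ψ₀ : Config N → ℂ} (hψ : Measurable ψ₀)
    (hper : ∀ (Y : Config N) (i : Fin N) (k : Fin 3),
      ψ₀ (Y + Pi.single i (EuclideanSpace.single k L)) = ψ₀ Y) :
    eLpNorm (periodicHeatFlow v N L t ψ₀) 2 (volume.restrict (cellN N L)) ≤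
      eLpNorm ψ₀ 2 (volume.restrict (cellN N L)) := by
  rw [eLpNorm_eq_lintegral_rpow_enorm_toReal two_ne_zero ENNReal.ofNat_ne_top,
    eLpNorm_eq_lintegral_rpow_enorm_toReal two_ne_zero ENNReal.ofNat_ne_top]
  simp only [ENNReal.toReal_ofNat, ENNReal.rpow_two]
  exact ENNReal.rpow_le_rpow (setLIntegral_cellN_enorm_periodicHeatFlow_sq_le hv hL t hψ hper)
    (by norm_num)

/-! ### The semigroup law

As in `GroundStateFeynmanKacSemigroup.lean`: to apply the Markov factorisation
`lintegral_comp_pathsShift_eq` the functional `ω ↦ e^{-∫₀ᵗ V^per} g(B_t)` is written as a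
measurable functional of RAW paths, read through the regularisation `pathRegularize` (the identity
on continuous paths), and identified on Brownian, shifted and stopped paths. -/

section Semigroup

open Literature.Probability.Process

/-- The raw periodised action `(Y, w) ↦ ∫₀ᵗ ∑_{i<j} v^per(·)(Y + √2 w̄(r)) dr` is measurable
(Tonelli). [folklore] -/
theorem measurable_rawPeriodicAction (N : ℕ) {v : ℝ → ℝ≥0∞} (hv : Measurable v) (L t : ℝ) :
    Measurable fun p : Config N × PathSpace N => ∫⁻ r in Set.Ioc (0 : ℝ) t,
      periodicInteraction v L (fun i : Fin N => p.1 i + WithLp.toLp 2 (fun k : Fin 3 =>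
        Real.sqrt 2 * pathRegularize (p.2 i k) r.toNNReal)) :=
  ((measurable_periodicInteraction hv L).comp (measurable_rawWorldLine N)).lintegral_prod_right'

/-- The raw periodic weight `(Y, w) ↦ e^{-raw action}` is measurable. [folklore] -/
theorem measurable_rawPeriodicWeight (N : ℕ) {v : ℝ → ℝ≥0∞} (hv : Measurable v) (L t : ℝ) :
    Measurable fun p : Config N × PathSpace N => expNeg (∫⁻ r in Set.Ioc (0 : ℝ) t,
      periodicInteraction v L (fun i : Fin N => p.1 i + WithLp.toLp 2 (fun k : Fin 3 =>
        Real.sqrt 2 * pathRegularize (p.2 i k) r.toNNReal))) :=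
  measurable_expNeg.comp (measurable_rawPeriodicAction N hv L t)

/-- **The raw periodic weight of the Brownian paths is the periodic weight.** [folklore] -/
theorem rawPeriodicWeight_pathsPath (v : ℝ → ℝ≥0∞) (L t : ℝ) (Y : Config N) (ω' : PathSpace N) :
    expNeg (∫⁻ r in Set.Ioc (0 : ℝ) t, periodicInteraction v L (fun i : Fin N => Y i +
      WithLp.toLp 2 (fun k : Fin 3 => Real.sqrt 2 *
        pathRegularize (fun u => brownian u (ω' i k)) r.toNNReal))) =
      periodicFKWeight v L t Y ω' := by
  simp only [periodicFKWeight, periodicPathAction, raw_worldLine_pathsPath]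

/-- **The raw periodic weight of the shifted paths, started from `B_s`, is the `[s, s+t]`-part of
the weight.** [folklore] -/
theorem rawPeriodicWeight_pathsShift (v : ℝ → ℝ≥0∞) (L : ℝ) (s : ℝ≥0) (t : ℝ) (X : Config N)
    (ω : PathSpace N) :
    expNeg (∫⁻ r in Set.Ioc (0 : ℝ) t, periodicInteraction v L (fun i : Fin N =>
      worldLine X ω s i + WithLp.toLp 2 (fun k : Fin 3 => Real.sqrt 2 * pathRegularize
        (fun u => brownian (s + u) (ω i k) - brownian s (ω i k)) r.toNNReal))) =
      expNeg (∫⁻ r in Set.Ioc (0 : ℝ) t,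
        periodicInteraction v L (worldLine X ω (s + r.toNNReal))) := by
  simp only [raw_worldLine_pathsShift]

/-- **The raw periodic weight of the stopped paths `u ↦ b_{u ∧ s}` on `[0, s]` is the weight on
`[0, s]`.** [folklore] -/
theorem rawPeriodicWeight_stopped (v : ℝ → ℝ≥0∞) (L : ℝ) (s : ℝ≥0) (X : Config N)
    (ω : PathSpace N) :
    expNeg (∫⁻ r in Set.Ioc (0 : ℝ) s, periodicInteraction v L (fun i : Fin N => X i +
      WithLp.toLp 2 (fun k : Fin 3 => Real.sqrt 2 *
        pathRegularize (fun u => brownian (min u s) (ω i k)) r.toNNReal))) =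
      periodicFKWeight v L s X ω := by
  have hact : (∫⁻ r in Set.Ioc (0 : ℝ) s, periodicInteraction v L (fun i : Fin N => X i +
      WithLp.toLp 2 (fun k : Fin 3 => Real.sqrt 2 *
        pathRegularize (fun u => brownian (min u s) (ω i k)) r.toNNReal))) =
      periodicPathAction v L s X ω := by
    simp only [periodicPathAction, raw_worldLine_stopped]
    refine setLIntegral_congr_fun measurableSet_Ioc (fun r hr => ?_)
    rw [min_eq_left (Real.toNNReal_le_iff_le_coe.2 hr.2)]
  rw [hact, periodicFKWeight]

/-- **Splitting the periodised action at time `s`**: `∫₀^{s+t} = ∫₀ˢ + ∫₀ᵗ (s + ·)`. [folklore] -/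
theorem periodicPathAction_add (v : ℝ → ℝ≥0∞) (L : ℝ) (s t : ℝ≥0) (X : Config N)
    (ω : PathSpace N) :
    periodicPathAction v L ((s : ℝ) + t) X ω = periodicPathAction v L s X ω +
      ∫⁻ r in Set.Ioc (0 : ℝ) t, periodicInteraction v L (worldLine X ω (s + r.toNNReal)) := by
  simp only [periodicPathAction]
  rw [← Set.Ioc_union_Ioc_eq_Ioc (a := (0 : ℝ)) (b := (s : ℝ)) s.coe_nonneg (by simp),
    lintegral_union measurableSet_Ioc (Set.Ioc_disjoint_Ioc.2 (by simp))]
  congr 1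
  rw [← lintegral_indicator measurableSet_Ioc, ← lintegral_indicator measurableSet_Ioc,
    ← lintegral_add_right_eq_self (μ := (volume : Measure ℝ)) _ (s : ℝ)]
  refine lintegral_congr fun r => ?_
  by_cases hr : r ∈ Set.Ioc (0 : ℝ) t
  · have hr' : r + s ∈ Set.Ioc (s : ℝ) (s + t) := ⟨by linarith [hr.1], by linarith [hr.2]⟩
    rw [Set.indicator_of_mem hr', Set.indicator_of_mem hr, add_comm r s, toNNReal_coe_add hr.1.le]
  · have hr' : r + s ∉ Set.Ioc (s : ℝ) (s + t) :=
      fun h => hr ⟨by linarith [h.1], by linarith [h.2]⟩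
    rw [Set.indicator_of_notMem hr', Set.indicator_of_notMem hr]

/-- **Splitting the periodic weight at time `s`** (multiplicativity of `e^{-∫V}`):
`w_{s+t}(ω) = w_s(ω) · e^{-∫₀ᵗ V^per(B_{s+r}) dr}`. [folklore] -/
theorem periodicFKWeight_add_eq_mul (v : ℝ → ℝ≥0∞) (L : ℝ) (s t : ℝ≥0) (X : Config N)
    (ω : PathSpace N) :
    periodicFKWeight v L ((s : ℝ) + t) X ω = periodicFKWeight v L s X ω *
      expNeg (∫⁻ r in Set.Ioc (0 : ℝ) t,
        periodicInteraction v L (worldLine X ω (s + r.toNNReal))) := by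
  rw [periodicFKWeight, periodicFKWeight, periodicPathAction_add, expNeg_add]

/-- **The periodic weight on `[0, s]` and the position at time `s` are functionals of the past**
`(b_u(ω i k))_{u ≤ s}` (read the stopped paths through the raw functionals). [folklore] -/
theorem measurable_comap_past_periodicFKWeight_worldLine {v : ℝ → ℝ≥0∞} (hv : Measurable v)
    (L : ℝ) (s : ℝ≥0) (X : Config N) :
    Measurable[MeasurableSpace.comap (fun (ω : PathSpace N) (i : Fin N) (k : Fin 3)
      (u : Set.Iic s) => brownian u (ω i k)) inferInstance]
      fun ω : PathSpace N => (periodicFKWeight v L s X ω, worldLine X ω s) := by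
  -- the raw functional `w ↦ (rawPeriodicWeight s X w, rawWorldLine X w s)`
  have hF : Measurable fun w : PathSpace N =>
      (expNeg (∫⁻ r in Set.Ioc (0 : ℝ) s, periodicInteraction v L (fun i : Fin N => X i +
        WithLp.toLp 2 (fun k : Fin 3 => Real.sqrt 2 * pathRegularize (w i k) r.toNNReal))),
      fun i : Fin N => X i + WithLp.toLp 2 (fun k : Fin 3 =>
        Real.sqrt 2 * pathRegularize (w i k) s)) :=
    ((measurable_rawPeriodicWeight N hv L s).comp (measurable_const.prodMk measurable_id)).prodMk
      ((measurable_rawWorldLine_at' N s).comp (measurable_const.prodMk measurable_id))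
  -- the stopped extension of a past
  have hEXT : Measurable fun (p : Fin N → Fin 3 → (Set.Iic s → ℝ)) (i : Fin N) (k : Fin 3)
      (u : ℝ≥0) => p i k ⟨min u s, min_le_right u s⟩ := by
    refine measurable_pi_lambda _ fun i => measurable_pi_lambda _ fun k =>
      measurable_pi_lambda _ fun u => ?_
    exact (measurable_pi_apply _).comp ((measurable_pi_apply k).comp (measurable_pi_apply i))
  have heq : (fun ω : PathSpace N => (periodicFKWeight v L s X ω, worldLine X ω s)) =
      ((fun w : PathSpace N =>
      (expNeg (∫⁻ r in Set.Ioc (0 : ℝ) s, periodicInteraction v L (fun i : Fin N => X i +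
        WithLp.toLp 2 (fun k : Fin 3 => Real.sqrt 2 * pathRegularize (w i k) r.toNNReal))),
      fun i : Fin N => X i + WithLp.toLp 2 (fun k : Fin 3 =>
        Real.sqrt 2 * pathRegularize (w i k) s))) ∘
      (fun (p : Fin N → Fin 3 → (Set.Iic s → ℝ)) (i : Fin N) (k : Fin 3) (u : ℝ≥0) =>
        p i k ⟨min u s, min_le_right u s⟩)) ∘
      fun (ω : PathSpace N) (i : Fin N) (k : Fin 3) (u : Set.Iic s) => brownian u (ω i k) := by
    funext ω
    simp only [Function.comp_apply]
    rw [rawPeriodicWeight_stopped v L s X ω, raw_worldLine_stopped X ω s s, min_self]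
  rw [heq]
  exact (hF.comp hEXT).comp (comap_measurable _)

/-- **Semigroup law of the periodic Feynman–Kac functional** (`ℝ≥0` times): for measurable `v`
and `g`, `(e^{-(s+t)H} g)(X) = (e^{-sH} (e^{-tH} g))(X)` for every `X` — the Markov property of
the world-lines at time `s` (`lintegral_comp_pathsShift_eq`) applied to the raw functional
`w ↦ e^{-∫₀ᵗ V^per} g(B_t)` started from `B_s`. Chung–Zhao (1995), §3.2 (display before
Thm 3.10), here without killing. [folklore] -/
theorem periodicFKSemigroup_add_nnreal {v : ℝ → ℝ≥0∞} (hv : Measurable v) (L : ℝ) (s t : ℝ≥0)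
    {g : Config N → ℝ≥0∞} (hg : Measurable g) (X : Config N) :
    periodicFKSemigroup v L ((s : ℝ) + t) g X =
      periodicFKSemigroup v L s (periodicFKSemigroup v L t g) X := by
  -- measurability of the raw functional `G((a, Y), w) = a · rawWeight t Y w · g(rawWorldLine Y w t)`
  have hGm : Measurable fun q : (ℝ≥0∞ × Config N) × PathSpace N =>
      q.1.1 * ((fun p : Config N × PathSpace N => expNeg (∫⁻ r in Set.Ioc (0 : ℝ) t,
        periodicInteraction v L (fun i : Fin N => p.1 i + WithLp.toLp 2 (fun k : Fin 3 =>
          Real.sqrt 2 * pathRegularize (p.2 i k) r.toNNReal)))) (q.1.2, q.2) *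
        g (fun i : Fin N => q.1.2 i + WithLp.toLp 2 (fun k : Fin 3 =>
          Real.sqrt 2 * pathRegularize (q.2 i k) t))) := by
    have hπ : Measurable fun q : (ℝ≥0∞ × Config N) × PathSpace N => (q.1.2, q.2) :=
      (measurable_snd.comp measurable_fst).prodMk measurable_snd
    refine (measurable_fst.comp measurable_fst).mul ?_
    exact ((measurable_rawPeriodicWeight N hv L t).comp hπ).mul
      (hg.comp ((measurable_rawWorldLine_at' N t).comp hπ))
  have key := lintegral_comp_pathsShift_eq N s
    (measurable_comap_past_periodicFKWeight_worldLine hv L s X) hGm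
  have e : ((s : ℝ) + t).toNNReal = s + t := by
    rw [← NNReal.coe_add, Real.toNNReal_coe]
  simp only [raw_worldLine_pathsShift, raw_worldLine_pathsPath] at key
  rw [periodicFKSemigroup, e, periodicFKSemigroup]
  simp only [periodicFKWeight_add_eq_mul v L s t X, mul_assoc]
  rw [key]
  refine lintegral_congr fun ω => ?_
  rw [lintegral_const_mul' _ _ (periodicFKWeight_ne_top v L s X ω)]
  simp only [periodicFKSemigroup, periodicFKWeight, periodicPathAction, Real.toNNReal_coe]

/-- **Semigroup law of the periodic Feynman–Kac functional**: for `s, t ≥ 0`, measurable `v` and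
`g`, and every `X`,
`periodicFKSemigroup v L (s + t) g X = periodicFKSemigroup v L s (periodicFKSemigroup v L t g) X`
(`e^{-(s+t)H} = e^{-sH} e^{-tH}` path-wise). [folklore] -/
theorem periodicFKSemigroup_add {v : ℝ → ℝ≥0∞} (hv : Measurable v) (L : ℝ) {s t : ℝ}
    (hs : 0 ≤ s) (ht : 0 ≤ t) {g : Config N → ℝ≥0∞} (hg : Measurable g) (X : Config N) :
    periodicFKSemigroup v L (s + t) g X =
      periodicFKSemigroup v L s (periodicFKSemigroup v L t g) X := by
  lift s to ℝ≥0 using hs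
  lift t to ℝ≥0 using ht
  exact periodicFKSemigroup_add_nnreal hv L s t hg X

end Semigroup

/-- The semigroup law on bounded NONNEGATIVE real data, read off the `[0,∞]`-valued functional.
[folklore] -/
theorem periodicHeatFlow_semigroup_ofReal_nonneg {v : ℝ → ℝ≥0∞} (hv : Measurable v) (L : ℝ)
    {s t : ℝ} (hs : 0 ≤ s) (ht : 0 ≤ t) {f : Config N → ℝ} (hf : Measurable f)
    (h0 : ∀ Y, 0 ≤ f Y) {C : ℝ} (hfC : ∀ Y, f Y ≤ C) :
    periodicHeatFlow v N L (s + t) (fun Y => (f Y : ℂ)) =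
      periodicHeatFlow v N L s (periodicHeatFlow v N L t fun Y => (f Y : ℂ)) := by
  have hgm : Measurable fun Y => ENNReal.ofReal (f Y) := ENNReal.measurable_ofReal.comp hf
  have hin : periodicHeatFlow v N L t (fun Y => (f Y : ℂ)) = fun Y =>
      (((periodicFKSemigroup v L t (fun Y => ENNReal.ofReal (f Y)) Y).toReal : ℝ) : ℂ) := by
    funext Y; exact periodicHeatFlow_ofReal_eq_periodicFKSemigroup hv L t hf h0 Y
  have hne : ∀ Y, periodicFKSemigroup v L t (fun Y => ENNReal.ofReal (f Y)) Y ≠ ⊤ := fun Y =>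
    (((periodicFKSemigroup_le_iSup v L t _ Y).trans
      (iSup_le fun Z => ENNReal.ofReal_le_ofReal (hfC Z))).trans_lt ENNReal.ofReal_lt_top).ne
  rw [hin]
  funext X
  rw [periodicHeatFlow_ofReal_eq_periodicFKSemigroup hv L s
      (measurable_periodicFKSemigroup hv L t hgm).ennreal_toReal (fun Y => ENNReal.toReal_nonneg) X,
    periodicHeatFlow_ofReal_eq_periodicFKSemigroup hv L (s + t) hf h0 X,
    periodicFKSemigroup_add hv L hs ht hgm X]
  congr 3
  funext Y
  exact (ENNReal.ofReal_toReal (hne Y)).symm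

/-- **Semigroup law of the periodic heat flow** on bounded measurable data:
`e^{-(s+t)H}ψ₀ = e^{-sH}(e^{-tH}ψ₀)` pointwise, for every measurable `v : ℝ → [0, ∞]` and
`s, t ≥ 0` (the Markov property of the world-lines, transferred to complex data by
`eq_of_eq_on_ofReal_nonneg`). [folklore] -/
theorem periodicHeatFlow_semigroup {v : ℝ → ℝ≥0∞} (hv : Measurable v) (L : ℝ) {s t : ℝ}
    (hs : 0 ≤ s) (ht : 0 ≤ t) {ψ₀ : Config N → ℂ} (hψ : Measurable ψ₀)
    (hb : ∃ C : ℝ, ∀ Y, ‖ψ₀ Y‖ ≤ C) :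
    periodicHeatFlow v N L (s + t) ψ₀ = periodicHeatFlow v N L s (periodicHeatFlow v N L t ψ₀) := by
  refine eq_of_eq_on_ofReal_nonneg (A := fun ψ => periodicHeatFlow v N L (s + t) ψ)
    (B := fun ψ => periodicHeatFlow v N L s (periodicHeatFlow v N L t ψ)) ?_ ?_ ?_ ?_ ?_ hψ hb
  · rintro φ ψ hφ hψ ⟨C₁, h₁⟩ ⟨C₂, h₂⟩
    exact periodicHeatFlow_add_of_bounded hv L _ hφ hψ h₁ h₂
  · intro c φ _ _
    exact periodicHeatFlow_smul v L _ c φ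
  · rintro φ ψ hφ hψ ⟨C₁, h₁⟩ ⟨C₂, h₂⟩
    rw [periodicHeatFlow_add_of_bounded hv L t hφ hψ h₁ h₂, periodicHeatFlow_add_of_bounded hv L s
      (measurable_periodicHeatFlow hv L t hφ) (measurable_periodicHeatFlow hv L t hψ)
      (norm_periodicHeatFlow_le v L t h₁) (norm_periodicHeatFlow_le v L t h₂)]
  · intro c φ _ _
    rw [periodicHeatFlow_smul, periodicHeatFlow_smul]
  · rintro f hf h0 ⟨C, hC⟩
    exact periodicHeatFlow_semigroup_ofReal_nonneg hv L hs ht hf h0 hC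

/-- **`t ↦ ‖e^{-tH}ψ₀‖²_{L²(cell)}` is non-increasing** on bounded measurable periodic data
(`L > 0`; semigroup law, periodicity of the flow, then the cell contraction). [folklore] -/
theorem setLIntegral_cellN_enorm_periodicHeatFlow_sq_add_le {v : ℝ → ℝ≥0∞} (hv : Measurable v)
    {L : ℝ} (hL : 0 < L) {s t : ℝ} (hs : 0 ≤ s) (ht : 0 ≤ t) {ψ₀ : Config N → ℂ}
    (hψ : Measurable ψ₀) (hb : ∃ C : ℝ, ∀ Y, ‖ψ₀ Y‖ ≤ C)
    (hper : ∀ (Y : Config N) (i : Fin N) (k : Fin 3),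
      ψ₀ (Y + Pi.single i (EuclideanSpace.single k L)) = ψ₀ Y) :
    ∫⁻ X in cellN N L, ‖periodicHeatFlow v N L (s + t) ψ₀ X‖ₑ ^ 2 ≤
      ∫⁻ X in cellN N L, ‖periodicHeatFlow v N L t ψ₀ X‖ₑ ^ 2 := by
  rw [periodicHeatFlow_semigroup hv L hs ht hψ hb]
  exact setLIntegral_cellN_enorm_periodicHeatFlow_sq_le hv hL s (measurable_periodicHeatFlow hv L t hψ)
    (fun Y i k => periodicHeatFlow_add_single_of_periodic v L t hper Y i k)

/-- `t ↦ ‖e^{-tH}ψ₀‖²_{L²(cell)}` is antitone on `[0, ∞)` (bounded measurable periodic data,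
`L > 0`). [folklore] -/
theorem setLIntegral_cellN_enorm_periodicHeatFlow_sq_antitoneOn {v : ℝ → ℝ≥0∞} (hv : Measurable v)
    {L : ℝ} (hL : 0 < L) {ψ₀ : Config N → ℂ} (hψ : Measurable ψ₀) (hb : ∃ C : ℝ, ∀ Y, ‖ψ₀ Y‖ ≤ C)
    (hper : ∀ (Y : Config N) (i : Fin N) (k : Fin 3),
      ψ₀ (Y + Pi.single i (EuclideanSpace.single k L)) = ψ₀ Y) :
    AntitoneOn (fun t : ℝ => ∫⁻ X in cellN N L, ‖periodicHeatFlow v N L t ψ₀ X‖ₑ ^ 2)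
      (Set.Ici 0) := by
  intro t ht t' _ htt'
  have h := setLIntegral_cellN_enorm_periodicHeatFlow_sq_add_le hv hL (sub_nonneg.2 htt') ht hψ hb
    hper
  rwa [sub_add_cancel] at h

end Literature.MathematicalPhysics.QuantumManyBody.BoseGas

end
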